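import Summits.Ventures.CertifiedManyBodySolver.Observables.PairODLROCeilingTL
import HarnessLib

/-!
# The uniform-in-`r` input, typed: a TAIL bound on the pair two-point function is an ODLRO ceiling

HONEST FRAMING: first certified bounds on pairing observables; not a superconductivity verdict; every
number certified (two lineages + referee) or labelled float. Crew hubbard-obs (D-0042), seat hubbard-obs-p1
(`prover-hubbard-obs-p1-g2-0`), lead ruling (ao1): «the ONLY path to an ODLRO statement informative vs print is
certified DECAY AT RANGE … PLUS a uniform-in-`r` input that no finite SDP supplies by itself». Pure harmonic
analysis (Wiener's lemma, `BraggWeightWiener.lean`); zero compute; no state-specific input; no named fact; no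
`sorry`; no definition.

`PairBoxCeilingSharpness.lean` shows that finite-range pair data cannot certify an ODLRO density below
`P(0)/M^d`. This file types the complementary POSITIVE statement — the exact shape of the missing input:

* `re_le_re_zero_of_represents` — a represented lattice function is dominated by its value at `0`:
  `|Re C(r)| ≤ Re C(0)` (total mass of the representing measure);
* **`braggWeight_zero_le_of_tail_bound`** (any `d`, any finite measure `μ` representing `C : ℤᵈ → ℂ`): if
  `Re C(j) ≤ η` for every `j` in the positive orthant with `‖j‖∞ ≥ R` (a TAIL bound, uniform in `j`), then
  **`braggWeight μ ![0] ≤ η`**. Proof: the Cesàro means `M^{-d} Σ_{j∈[0,M)ᵈ} Re C(j)` converge to the Bragg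
  weight (Wiener, `tendsto_boxMean_re_braggWeight`); the `≤ R^d` near terms contribute `≤ R^d·Re C(0)/M^d → 0`,
  the others `≤ η` each;
* `dWavePair_braggWeight_le_of_tail_bound` — for a translation-invariant `ω : InfVolFermionState 2` and every
  measure representing `r ↦ ω.dWavePairCorr 0 r`: a tail bound `Re ω.dWavePairCorr 0 r ≤ η` (`‖r‖∞ ≥ R`, `r ≥ 0`)
  gives `m_d² = braggWeight μ ![0] ≤ η` — so ANY future clustering / decay theorem for the ground states of the
  class, uniform in `r` beyond some range, converts directly into the ODLRO ceiling that the box functionals cannot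
  deliver (and, through `M3ObsPairLROCeilingAt_tp0`-type leaves, into `StripePointCeiling`).
HONEST: this file supplies no tail bound; it records what a tail bound would buy. One-sided (`Re C ≤ η`) suffices.

References: Katznelson, *An Introduction to Harmonic Analysis* (2004) I.7 (Wiener's lemma on atoms as Cesàro
limits); Yang, Rev. Mod. Phys. 34 (1962) 694 §3.
-/

noncomputable section

open MeasureTheory Complex Filter Topology
open scoped Real BigOperators

namespace Summit.Ventures.CertifiedManyBodySolver.Observables

section General

variable {d : ℕ} {C : (Fin d → ℤ) → ℂ} (μ : Measure (EuclideanSpace ℝ (Fin d))) [IsFiniteMeasure μ]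

omit [IsFiniteMeasure μ] in
/-- A represented lattice function is dominated by its value at the origin: `‖C r‖ ≤ Re C(0)` (`= μ(ℝᵈ)`).
[cite: Katznelson2004, I.7] -/
theorem norm_le_re_zero_of_represents
    (hμ : ∀ r : Fin d → ℤ, ∫ ξ, exp ((∑ i, (r i : ℝ) * ξ i : ℝ) * I) ∂μ = C r) (r : Fin d → ℤ) :
    ‖C r‖ ≤ (C 0).re := by
  rw [← hμ r, ← measureReal_univ_eq_re_zero μ hμ]
  refine (norm_integral_le_integral_norm _).trans ?_
  have h1 : ∫ ξ, ‖exp ((∑ i, (r i : ℝ) * ξ i : ℝ) * I)‖ ∂μ = ∫ _ξ, (1 : ℝ) ∂μ :=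
    integral_congr_ae (ae_of_all _ fun ξ => by simp only [Complex.norm_exp_ofReal_mul_I])
  rw [h1, integral_const, smul_eq_mul, mul_one]

omit [IsFiniteMeasure μ] in
/-- Hence `Re C(r) ≤ Re C(0)` for every `r`. -/
theorem re_le_re_zero_of_represents
    (hμ : ∀ r : Fin d → ℤ, ∫ ξ, exp ((∑ i, (r i : ℝ) * ξ i : ℝ) * I) ∂μ = C r) (r : Fin d → ℤ) :
    (C r).re ≤ (C 0).re :=
  (Complex.re_le_norm _).trans (norm_le_re_zero_of_represents μ hμ r)

/-- The box Cesàro mean at `Q = 0` is the plain average: `Re boxMean C 0 M = M^{-d} Σ_{j∈[0,M)ᵈ} Re C(j)`. -/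
theorem re_boxMean_zero (C : (Fin d → ℤ) → ℂ) (M : ℕ) :
    (boxMean C (0 : Fin d → ℝ) M).re =
      (∑ j ∈ Fintype.piFinset (fun _ : Fin d => Finset.range M), (C (fun i => (j i : ℤ))).re) / (M : ℝ) ^ d := by
  unfold boxMean
  simp only [Pi.zero_apply, mul_zero, Finset.sum_const_zero, Complex.ofReal_zero, neg_zero, zero_mul,
    Complex.exp_zero, one_mul]
  rw [show ((M : ℂ)) ^ d = ((M ^ d : ℕ) : ℂ) by push_cast; rfl, Complex.div_natCast_re, Complex.re_sum]
  push_cast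
  rfl

/-- **A uniform TAIL bound on the pair (or any represented) two-point function is an ODLRO ceiling.**  If
`Re C(j) ≤ η` for every `j` in the positive orthant with some coordinate `≥ R`, then `braggWeight μ ![0] ≤ η`.
(Wiener: the Bragg weight is the Cesàro limit; near terms are `O(R^d/M^d)`.) [cite: Katznelson2004, I.7] -/
theorem braggWeight_zero_le_of_tail_bound (hd : 1 ≤ d)
    (hμ : ∀ r : Fin d → ℤ, ∫ ξ, exp ((∑ i, (r i : ℝ) * ξ i : ℝ) * I) ∂μ = C r)
    (R : ℕ) (η : ℝ)
    (htail : ∀ j : Fin d → ℤ, (∀ i, 0 ≤ j i) → (∃ i, (R : ℤ) ≤ j i) → (C j).re ≤ η) :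
    braggWeight μ ![(0 : Fin d → ℝ)] ≤ η := by
  set c₀ : ℝ := (C 0).re with hc₀
  have hc₀nn : 0 ≤ c₀ := (norm_nonneg _).trans (norm_le_re_zero_of_represents μ hμ 0)
  -- the Cesàro means converge to the Bragg weight
  have hlim := tendsto_boxMean_re_braggWeight μ hμ (0 : Fin d → ℝ)
  -- each Cesàro mean is `≤ η + K / M^d` with `K = R^d (Re C(0) + |η|)`
  set K : ℝ := (R : ℝ) ^ d * (c₀ + |η|) with hK
  have hKnn : 0 ≤ K := by positivity
  have hbound : ∀ M : ℕ, 1 ≤ M → (boxMean C (0 : Fin d → ℝ) M).re ≤ η + K / (M : ℝ) ^ d := by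
    intro M hM
    have hMpos : (0 : ℝ) < (M : ℝ) ^ d := by positivity
    rw [re_boxMean_zero, div_le_iff₀ hMpos, add_mul, div_mul_cancel₀ _ hMpos.ne']
    -- split the box into the near part (all coordinates `< R`) and the tail
    set box := Fintype.piFinset (fun _ : Fin d => Finset.range M) with hbox
    set near := box.filter (fun j => ∀ i, j i < R) with hnear
    set far := box.filter (fun j => ¬ ∀ i, j i < R) with hfar
    have hsplit : ∑ j ∈ box, (C (fun i => (j i : ℤ))).re =
        ∑ j ∈ near, (C (fun i => (j i : ℤ))).re + ∑ j ∈ far, (C (fun i => (j i : ℤ))).re :=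
      (Finset.sum_filter_add_sum_filter_not box (fun j => ∀ i, j i < R) _).symm
    -- near part: at most `R^d` terms, each `≤ c₀`
    have hnear_card : (near.card : ℝ) ≤ (R : ℝ) ^ d := by
      have hsub : near ⊆ Fintype.piFinset (fun _ : Fin d => Finset.range R) := by
        intro j hj
        rw [hnear, Finset.mem_filter] at hj
        exact Fintype.mem_piFinset.2 fun i => Finset.mem_range.2 (hj.2 i)
      have := Finset.card_le_card hsub
      rw [Fintype.card_piFinset, Finset.prod_const, Finset.card_range, Finset.card_univ, Fintype.card_fin] at this
      exact_mod_cast this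
    have hnear_le : ∑ j ∈ near, (C (fun i => (j i : ℤ))).re ≤ (R : ℝ) ^ d * c₀ :=
      calc ∑ j ∈ near, (C (fun i => (j i : ℤ))).re ≤ ∑ _j ∈ near, c₀ :=
            Finset.sum_le_sum fun j _ => re_le_re_zero_of_represents μ hμ _
        _ = near.card * c₀ := by rw [Finset.sum_const, nsmul_eq_mul]
        _ ≤ (R : ℝ) ^ d * c₀ := mul_le_mul_of_nonneg_right hnear_card hc₀nn
    -- far part: each term `≤ η`, at most `M^d` terms
    have hfar_card : (far.card : ℝ) ≤ (M : ℝ) ^ d := by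
      have := Finset.card_le_card (Finset.filter_subset (fun j => ¬ ∀ i, j i < R) box)
      rw [hbox, Fintype.card_piFinset, Finset.prod_const, Finset.card_range, Finset.card_univ,
        Fintype.card_fin] at this
      exact_mod_cast this
    have hfar_le : ∑ j ∈ far, (C (fun i => (j i : ℤ))).re ≤ (M : ℝ) ^ d * η + (R : ℝ) ^ d * |η| := by
      have hterm : ∀ j ∈ far, (C (fun i => (j i : ℤ))).re ≤ η := by
        intro j hj
        rw [hfar, Finset.mem_filter] at hj
        obtain ⟨i, hi⟩ := not_forall.1 hj.2
        exact htail _ (fun i => by exact_mod_cast Nat.zero_le (j i)) ⟨i, by exact_mod_cast not_lt.1 hi⟩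
      calc ∑ j ∈ far, (C (fun i => (j i : ℤ))).re ≤ ∑ _j ∈ far, η := Finset.sum_le_sum hterm
        _ = far.card * η := by rw [Finset.sum_const, nsmul_eq_mul]
        _ ≤ (M : ℝ) ^ d * η + (R : ℝ) ^ d * |η| := by
            rcases le_or_gt 0 η with hη | hη
            · have h1 : (far.card : ℝ) * η ≤ (M : ℝ) ^ d * η := mul_le_mul_of_nonneg_right hfar_card hη
              have h2 : 0 ≤ (R : ℝ) ^ d * |η| := by positivity
              linarith
            · -- η < 0: every far term ≤ η < 0, and far.card ≥ M^d - R^d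
              have hcard_ge : (M : ℝ) ^ d - (R : ℝ) ^ d ≤ (far.card : ℝ) := by
                have hsum : (near.card : ℝ) + far.card = (M : ℝ) ^ d := by
                  have := Finset.card_filter_add_card_filter_not (s := box) (fun j => ∀ i, j i < R)
                  rw [hbox, Fintype.card_piFinset, Finset.prod_const, Finset.card_range, Finset.card_univ,
                    Fintype.card_fin] at this
                  rw [hnear, hfar, hbox]
                  exact_mod_cast this
                linarith
              have : (far.card : ℝ) * η ≤ ((M : ℝ) ^ d - (R : ℝ) ^ d) * η :=
                mul_le_mul_of_nonpos_right hcard_ge hη.le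
              rw [abs_of_neg hη]
              nlinarith
    have hK' : K = (R : ℝ) ^ d * c₀ + (R : ℝ) ^ d * |η| := by rw [hK]; ring
    rw [hsplit, hK']
    linarith [hnear_le, hfar_le]
  -- pass to the limit
  have hcomp : Tendsto (fun M : ℕ => η + K / (M : ℝ) ^ d) atTop (𝓝 η) := by
    have h0 : Tendsto (fun M : ℕ => ((M : ℝ) ^ d)⁻¹) atTop (𝓝 0) := by
      have h := (tendsto_pow_atTop (α := ℝ) (by omega : d ≠ 0)).comp tendsto_natCast_atTop_atTop
      exact h.inv_tendsto_atTop
    have h1 := (h0.const_mul K).const_add η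
    rw [mul_zero, add_zero] at h1
    refine h1.congr' (Eventually.of_forall fun M => ?_)
    simp [div_eq_mul_inv]
  exact le_of_tendsto_of_tendsto' (hlim.comp (tendsto_add_atTop_nat 1)) (hcomp.comp (tendsto_add_atTop_nat 1))
    fun M => hbound (M + 1) (Nat.le_add_left 1 M)

/-- **d-wave pair form.** For a state `ω : InfVolFermionState 2` and any finite measure `μ` representing its
`d`-wave pair two-point function `r ↦ ω.dWavePairCorr 0 r`: a uniform tail bound `Re ω.dWavePairCorr 0 r ≤ η` for
all `r ≥ 0` with `‖r‖∞ ≥ R` gives the ODLRO ceiling `braggWeight μ ![0] ≤ η` — the input that, unlike any finite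
family of certified cells (`PairBoxCeilingSharpness`), reaches below `P_d(0,0)/|B|`. [cite: Yang1962, §3] -/
theorem dWavePair_braggWeight_le_of_tail_bound {ω : Literature.MathematicalPhysics.QuantumLattice.InfVolFermionState 2}
    (μ : Measure (EuclideanSpace ℝ (Fin 2))) [IsFiniteMeasure μ]
    (hμ : ∀ r : Fin 2 → ℤ, ∫ ξ, exp ((∑ i, (r i : ℝ) * ξ i : ℝ) * I) ∂μ = ω.dWavePairCorr 0 r)
    (R : ℕ) (η : ℝ)
    (htail : ∀ r : Fin 2 → ℤ, (∀ i, 0 ≤ r i) → (∃ i, (R : ℤ) ≤ r i) → (ω.dWavePairCorr 0 r).re ≤ η) :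
    braggWeight μ ![(0 : Fin 2 → ℝ)] ≤ η :=
  braggWeight_zero_le_of_tail_bound μ (by norm_num) hμ R η htail

end General

end Summit.Ventures.CertifiedManyBodySolver.Observables

end
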